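import Mathlib
import Summits.Ventures.PercRepro2.Defs
import Summits.Ventures.PercRepro2.Graph
import Summits.Ventures.PercRepro2.Harris
import Summits.Ventures.PercRepro2.Events
import Summits.Ventures.PercRepro2.Independence
import Summits.Ventures.PercRepro2.Induced
import Summits.Ventures.PercRepro2.ContractDefs
import Summits.Ventures.PercRepro2.GateDefs
import Summits.Ventures.PercRepro2.HullTree
import Summits.Ventures.PercRepro2.GateFeedbackForest
import Summits.Ventures.PercRepro2.GateFeedbackGeneral
import Summits.Ventures.PercRepro2.GateContract

/-!
# The shadow of the avoided set: only the components of the root and of the exit matter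
(blind cell PercRepro2, mine-c g10; proofs/MINEC-FEEDBACK.md §6′)

Lens «grow the avoided set»: a vertex that can be reached from the root `s` only through `T`,
and from the exit `w` only through `T`, is invisible to the gate. Formally, let
`shadow ends T s w` be the set of vertices reachable from neither `s` nor `w` in `G − T`
(it contains `T`). Then `R_{shadow} = R_T` (`avoidAll_shadow`), the hull event
`{w ∈ hull(shadow)} = {w ∈ hull(T)}` (`hitsK_shadow`), and the whole cleared gate expression is
unchanged (`gateRow_shadow_iff`) — the potential is CONSERVED under this growth of the avoided set.
Combining with `GateContract.gateRow_of_isForest_del_set` (the avoided-set feedback-vertex gate):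

**THEOREM** (`gateRow_of_isForest_shadow`): `(GATE A,{w})` holds at the avoided set `T` whenever
the edges of `G − T` within the components of `s` and of `w` form a forest — the components of
`G − T` not containing `s` or `w` are arbitrary (they may carry any cycles).
-/

namespace Summit.Ventures.PercRepro2

namespace GateShadow

open scoped Classical

variable {V : Type*} {E : Type*}

/-! ## Reachability in `G − T` -/

/-- Reachability in `G − T` is `Conn (GateContract.endsDel ends T) (fun _ => true)` (all edges
avoiding `T` open). A vertex of `T` is isolated in `G − T`: it is reachable only from itself. -/
lemma eq_of_reachDel_mem {ends : E → Sym2 V} {T : Finset V} {x t : V} (ht : t ∈ T)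
    (h : Conn (GateContract.endsDel ends T) (fun _ => true) x t) : x = t :=
  GateContract.eq_of_conn_of_isolated (fun e => e.2 t ht) h

/-- **An open connection of `G` to a vertex not reachable in `G − T` passes through `T`**:
`x ↔ y` and `y` not `G − T`-reachable from `x` give `x ↔ t` for some `t ∈ T`. -/
lemma exists_conn_mem_of_not_reachDel {ends : E → Sym2 V} {T : Finset V} {ω : Config E}
    {x y : V} (h : Conn ends ω x y) (hn : ¬ Conn (GateContract.endsDel ends T) (fun _ => true) x y) :
    ∃ t ∈ T, Conn ends ω x t := by
  obtain ⟨q⟩ := h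
  by_cases hT : ∃ t ∈ T, t ∈ q.support
  · obtain ⟨t, ht, hq⟩ := hT
    exact ⟨t, ht, ⟨q.takeUntil t hq⟩⟩
  · simp only [not_exists, not_and] at hT
    exfalso
    apply hn
    refine ⟨q.transfer (openGraph (GateContract.endsDel ends T) (fun _ => true)) ?_⟩
    intro e he
    induction e using Sym2.ind with
    | h a b =>
      have hadj : (openGraph ends ω).Adj a b := q.adj_of_mem_edges he
      have ha : a ∈ q.support := q.fst_mem_support_of_mem_edges he
      have hb : b ∈ q.support := q.snd_mem_support_of_mem_edges he
      rw [openGraph_adj] at hadj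
      obtain ⟨hne, e', _, hends⟩ := hadj
      have hF : ∀ t ∈ T, t ∉ ends e' := by
        intro t ht hmem
        rw [hends, Sym2.mem_iff] at hmem
        rcases hmem with h | h
        · exact hT t ht (by rw [h]; exact ha)
        · exact hT t ht (by rw [h]; exact hb)
      rw [SimpleGraph.mem_edgeSet, openGraph_adj]
      exact ⟨hne, ⟨e', hF⟩, rfl, hends⟩

/-! ## The shadow -/

section Shadow

variable [Fintype V]

/-- **The shadow of `T`** seen from `s` and `w`: the vertices reachable from neither `s` nor
`w` in `G − T` (contains `T` when `s, w ∉ T`). -/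
noncomputable def shadow (ends : E → Sym2 V) (T : Finset V) (s w : V) : Finset V :=
  Finset.univ.filter fun x => ¬ Conn (GateContract.endsDel ends T) (fun _ => true) s x ∧
    ¬ Conn (GateContract.endsDel ends T) (fun _ => true) w x

variable {ends : E → Sym2 V} {T : Finset V} {s w : V}

/-- Membership in the shadow. -/
lemma mem_shadow {x : V} :
    x ∈ shadow ends T s w ↔ ¬ Conn (GateContract.endsDel ends T) (fun _ => true) s x ∧
      ¬ Conn (GateContract.endsDel ends T) (fun _ => true) w x := by
  simp [shadow]

/-- `T ⊆ shadow` (for `s, w ∉ T`). -/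
lemma subset_shadow (hs : s ∉ T) (hw : w ∉ T) : T ⊆ shadow ends T s w := by
  intro t ht
  rw [mem_shadow]
  exact ⟨fun h => hs ((eq_of_reachDel_mem ht h) ▸ ht), fun h => hw ((eq_of_reachDel_mem ht h) ▸ ht)⟩

/-- The root is not in the shadow. -/
lemma root_notMem_shadow : s ∉ shadow ends T s w := by
  rw [mem_shadow]
  exact fun h => h.1 (conn_refl _ _ _)

/-- The exit is not in the shadow. -/
lemma exit_notMem_shadow : w ∉ shadow ends T s w := by
  rw [mem_shadow]
  exact fun h => h.2 (conn_refl _ _ _)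

/-- **`R_{shadow} = R_T`**: avoiding the shadow is avoiding `T`. -/
theorem avoidAll_shadow (hs : s ∉ T) (hw : w ∉ T) :
    avoidAll ends s (shadow ends T s w) = avoidAll ends s T := by
  ext ω
  simp only [avoidAll, Set.mem_setOf_eq]
  constructor
  · intro h t ht
    exact h t (subset_shadow hs hw ht)
  · intro h x hx hc
    obtain ⟨t, ht, hc'⟩ := exists_conn_mem_of_not_reachDel hc ((mem_shadow.1 hx).1)
    exact h t ht hc'

/-- **The hull event is unchanged**: `w ∈ hull(shadow) ↔ w ∈ hull(T)`. -/
theorem hitsK_shadow (hs : s ∉ T) (hw : w ∉ T) :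
    Gate.hitsK ends (shadow ends T s w) {w} = Gate.hitsK ends T {w} := by
  ext ω
  simp only [Gate.hitsK, Set.mem_setOf_eq, Finset.mem_singleton, exists_eq_left]
  constructor
  · rintro ⟨x, hx, hc⟩
    obtain ⟨t, ht, hc'⟩ :=
      exists_conn_mem_of_not_reachDel (conn_symm hc) ((mem_shadow.1 hx).2)
    exact ⟨t, ht, conn_symm hc'⟩
  · rintro ⟨t, ht, hc⟩
    exact ⟨t, subset_shadow hs hw ht, hc⟩

/-- **The gate event is unchanged.** -/
theorem gateEvent_shadow (hs : s ∉ T) (hw : w ∉ T) (A : Finset V) :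
    Gate.gateEvent ends s (shadow ends T s w) A {w} = Gate.gateEvent ends s T A {w} := by
  unfold Gate.gateEvent
  rw [avoidAll_shadow hs hw, hitsK_shadow hs hw]

end Shadow

/-! ## The cleared gate expression is conserved -/

section Row

variable [Fintype E] [Fintype V] {R : Type*} [Field R] [LinearOrder R]
variable {ends : E → Sym2 V} {T : Finset V} {s w : V}

/-- **(GATE A,{w}) at the shadow is (GATE A,{w}) at `T`** (`s, w ∉ T`). -/
theorem gateRow_shadow_iff (p : E → R) (hs : s ∉ T) (hw : w ∉ T) (a b : V) (A : Finset V) :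
    Gate.GateRow p ends s (shadow ends T s w) a b A {w} ↔ Gate.GateRow p ends s T a b A {w} := by
  unfold Gate.GateRow
  rw [avoidAll_shadow hs hw, gateEvent_shadow hs hw A]

end Row

/-! ## The theorem -/

section Theorem

variable [Fintype E] [Fintype V]
variable {R : Type*} [Field R] [LinearOrder R] [IsStrictOrderedRing R]

/-- **THEOREM (the gate sees only the components of the root and of the exit).** If the edges of
`G − T` within the components of `s` and of `w` form a forest (`G − shadow` is a forest: every
other component of `G − T` is arbitrary), then `(GATE A,{w})` holds at the avoided set `T`
(`T` non-empty, `s, w ∉ T`), for every entry set `A` and markers `a, b`. -/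
theorem gateRow_of_isForest_shadow {p : E → R} (hp : IsProbVec p) {ends : E → Sym2 V}
    (s : V) (T : Finset V) (t₀ : V) (a b w : V) (A : Finset V) (ht₀ : t₀ ∈ T) (hs : s ∉ T)
    (hw : w ∉ T) (hF : Hull.IsForest (GateContract.endsDel ends (shadow ends T s w))) :
    Gate.GateRow p ends s T a b A {w} := by
  rw [← gateRow_shadow_iff p hs hw a b A]
  exact GateContract.gateRow_of_isForest_del_set hp s (shadow ends T s w) t₀ a b w A
    (subset_shadow hs hw ht₀) root_notMem_shadow exit_notMem_shadow hF

/-- The free one-sided gate `(ARC u⇐w)` when the components of `s` and `w` in `G − T` are trees. -/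
theorem gateRow_free_of_isForest_shadow {p : E → R} (hp : IsProbVec p) {ends : E → Sym2 V}
    (s : V) (T : Finset V) (t₀ : V) (a b u w : V) (ht₀ : t₀ ∈ T) (hs : s ∉ T) (hw : w ∉ T)
    (hF : Hull.IsForest (GateContract.endsDel ends (shadow ends T s w))) :
    Gate.GateRow p ends s T a b {u} {w} :=
  gateRow_of_isForest_shadow hp s T t₀ a b w {u} ht₀ hs hw hF

/-- The single-vertex form: `(GATE A,{w})` at `t` whenever the components of `s` and `w` in
`G − t` are trees. -/
theorem gateRow_of_isForest_shadow_single {p : E → R} (hp : IsProbVec p) {ends : E → Sym2 V}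
    (s t a b w : V) (A : Finset V) (hs : s ≠ t) (hw : w ≠ t)
    (hF : Hull.IsForest (GateContract.endsDel ends (shadow ends {t} s w))) :
    Gate.GateRow p ends s {t} a b A {w} :=
  gateRow_of_isForest_shadow hp s {t} t a b w A (Finset.mem_singleton_self t)
    (by simpa using hs) (by simpa using hw) hF

end Theorem

end GateShadow

end Summit.Ventures.PercRepro2
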